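import Literature.NumberTheory.Automorphic.BrandtWeightKJacquetLanglands
import Literature.NumberTheory.EllipticCurves.HeckeTnGamma0
import Literature.NumberTheory.EllipticCurves.NewformsStrongMultiplicityOneProofs
import Literature.NumberTheory.EllipticCurves.NewformsFiniteProofs
import Mathlib.NumberTheory.ArithmeticFunction.Moebius
import HarnessLib

/-!
# Multiplicities of eigenvalue systems in `S_k(Γ₀(L))` and the `N⁻`-new count
# (the Atkin–Lehner packaging step of the weight-`k` Jacquet–Langlands fact
# `jacquetLanglands_newform_of_brandtEigenformLite`)

Topic `Literature/NumberTheory/Automorphic`; theorems only (no definition, no named fact, no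
instance; D-0026). Second proof-only sibling of `BrandtWeightKJacquetLanglands.lean`.

Every printed proof of the Eichler / Jacquet–Langlands correspondence for a definite quaternion
algebra of discriminant `N⁻` and an Eichler order of level `N⁺` over `ℚ` by the trace formula
(Eichler, LNM 320 (1973), Ch. IV §1; Pizer, J. Algebra 64 (1980), Thm. 2.28; Hijikata–Pizer–Shemanske
1989, §7) ends with the same packaging step on the modular side: once the traces of the Brandt
matrices `B_k(n)`, `(n, N) = 1`, are identified with the alternating combination
`Σ_{d ∣ N⁻} μ(N⁻/d) σ₀(N⁻/d) tr (T_n | S_k(Γ₀(d N⁺)))` — the trace of `T_n` on the `N⁻`-new part of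
`S_k(Γ₀(N⁺N⁻))` — the multiplicity of an eigenvalue system `χ = (χ(q))_{q ∤ N}` in the Brandt module
equals `Σ_{d ∣ N⁻} μ(N⁻/d) σ₀(N⁻/d) m_χ(d N⁺)`, `m_χ(L) = dim {f ∈ S_k(Γ₀(L)) : T_q f = χ(q) f ∀ q ∤ N}`,
and Atkin–Lehner theory evaluates this combination: it is `σ₀(N⁺/M)` if `χ` is the system of a
newform of level `N⁻M`, `M ∣ N⁺`, and `0` otherwise. This file proves exactly that evaluation, for
every weight `k ∈ ℤ`, from the tree's (fully proved) Atkin–Lehner theory: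

* `finrank_eigenChar_eq_card_of_basis` — linear algebra: if a basis consists of simultaneous
  eigenvectors of a family `T q` with systems `ψ i`, the simultaneous eigenspace of `χ` is spanned by
  the basis vectors with `ψ i = χ` and has dimension `#{i : ψ i = χ}`.
* `finrank_eigenChar_heckeTnGamma0_eq_natCard` — for `L ∣ N`,
  `m_χ(L) = #{((M, g), d) : g ∈ newforms0 M k, M d ∣ L, a_q(g) = χ(q) ∀ q ∤ N}` (the Atkin–Lehner
  basis `[α_d]_k g` of `S_k(Γ₀(L))`, `linearIndependent_degeneracyMap0_newforms` /
  `span_range_degeneracyMap0_newforms`, consists of simultaneous `T_q`-eigenvectors,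
  `heckeT_degeneracyMap0`; Atkin–Lehner 1970, Thm. 3 and Thm. 5).
* `sigmaNewform_eq_of_coeff_eq_off` — strong multiplicity one off `N`: at most one pair `(M, g)`,
  `M ∣ L`, has `a_q(g) = χ(q)` for all primes `q ∤ N`
  (`IsNewform0.level_eq_of_heckeEigenvalue_eq_holds`, `IsNewform0.eq_of_heckeEigenvalue_eq_holds`;
  Atkin–Lehner 1970, Thm. 4).
* `finrank_eigenChar_heckeTnGamma0_eq_card_divisors`, `finrank_eigenChar_heckeTnGamma0_eq_zero` —
  hence `m_χ(L) = σ₀(L/M)` if `χ` is the system of `g ∈ newforms0 M k` with `M ∣ L`, and `m_χ(L) = 0`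
  if no newform of level dividing `L` has system `χ` off `N` (Diamond–Shurman Thm. 5.8.3).
* `sum_moebius_mul_card_divisors_mul_card_divisors` — `Σ_{e ∣ n} μ(n/e) σ₀(n/e) σ₀(e) = [n = 1]` for
  squarefree `n` (the Dirichlet convolution of the multiplicative functions `μ σ₀` and `σ₀` vanishes
  at every prime: `2 - 2 = 0`).
* `moebius_sum_finrank_eigenChar_eq_zero_or_exists_newform` /
  `exists_newform_of_moebius_sum_ne_zero` — **the packaging step**: for `N = N⁺N⁻`,
  `(N⁺, N⁻) = 1`, `N⁻` squarefree,
  `Σ_{d ∣ N⁻} μ(N⁻/d) σ₀(N⁻/d) m_χ(d N⁺) ≠ 0` implies that `χ` is the eigenvalue system of a newform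
  `g ∈ S_k(Γ₀(N⁻M))` for some `M ∣ N⁺` (and then the sum is `σ₀(N⁺/M)`).

## References

* [Eichler1973] M. Eichler, LNM 320 (1973), Ch. IV §1 (the basis problem, induction on the primes of
  the level).
* [Pizer1980] A. Pizer, J. Algebra 64 (1980), Thm. 2.28 and its proof (p. 360).
* [AtkinLehner1970] A. O. L. Atkin, J. Lehner, Math. Ann. 185 (1970), Thm. 3, Thm. 4, Thm. 5.
* [DiamondShurman2005] F. Diamond, J. Shurman, GTM 228, Thm. 5.8.2, Thm. 5.8.3.
-/

noncomputable section

open scoped BigOperators MatrixGroups ModularForm ArithmeticFunction.Moebius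
  ArithmeticFunction.sigma
open CongruenceSubgroup Module Module.End UpperHalfPlane ArithmeticFunction

namespace Literature.NumberTheory.Automorphic

namespace BrandtWeightK

open Literature.NumberTheory.EllipticCurves.ModularForms

/-! ### Linear algebra: simultaneous eigenspaces read off an eigenbasis -/

section LinAlg

variable {ι V : Type*} [AddCommGroup V] [Module ℂ V] [Fintype ι] {N : ℕ}

/-- **Simultaneous eigenspaces read off an eigenbasis.** If the basis `b` of `V` consists of
simultaneous eigenvectors of the operators `T q` (`q ∤ N` prime), `T q (b i) = ψ i q • b i`, then
the simultaneous eigenspace of the system `χ` is the span of the `b i` with `ψ i = χ`: a vector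
`v = Σ c_i b_i` with `T q v = χ(q) v` has `c_i (ψ i q - χ q) = 0` for all `i, q`. [folklore] -/
theorem eigenChar_eq_span_image_of_basis (T : ℕ → Module.End ℂ V) (b : Module.Basis ι ℂ V)
    (ψ : ι → PrimesNotDvd N → ℂ) (hb : ∀ (i : ι) (q : PrimesNotDvd N), T q (b i) = ψ i q • b i)
    (χ : PrimesNotDvd N → ℂ) :
    eigenChar N T χ = Submodule.span ℂ (b '' {i | ψ i = χ}) := by
  classical
  apply le_antisymm
  · intro v hv
    rw [mem_eigenChar_iff] at hv
    rw [b.mem_span_image]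
    intro i hi
    rw [Finset.mem_coe, Finsupp.mem_support_iff] at hi
    -- `hi : b.repr v i ≠ 0`; show `ψ i = χ`
    by_contra hne
    obtain ⟨q, hq⟩ : ∃ q, ψ i q ≠ χ q := Function.ne_iff.mp hne
    -- expand `T q v` on the basis in two ways
    have hsum : ∑ j, b.repr v j • b j = v := b.sum_repr v
    have h1 : T q v = ∑ j, (b.repr v j * ψ j q) • b j := by
      conv_lhs => rw [← hsum]
      rw [map_sum]
      refine Finset.sum_congr rfl fun j _ => ?_
      rw [map_smul, hb, smul_smul]
    have h2 : T q v = ∑ j, (χ q * b.repr v j) • b j := by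
      rw [hv q]
      conv_lhs => rw [← hsum]
      rw [Finset.smul_sum]
      refine Finset.sum_congr rfl fun j _ => ?_
      rw [smul_smul]
    have e1 := congrFun (b.repr_sum_self fun j => b.repr v j * ψ j q) i
    have e2 := congrFun (b.repr_sum_self fun j => χ q * b.repr v j) i
    have hrepr : b.repr v i * ψ i q = χ q * b.repr v i := by
      rw [← e1, ← e2, ← h1, ← h2]
    -- `b.repr v i * ψ i q = χ q * b.repr v i`
    have : b.repr v i * (ψ i q - χ q) = 0 := by rw [mul_sub, hrepr]; ring
    rcases mul_eq_zero.mp this with h0 | h0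
    · exact hi h0
    · exact hq (sub_eq_zero.mp h0)
  · rw [Submodule.span_le]
    rintro _ ⟨i, hi, rfl⟩
    rw [SetLike.mem_coe, mem_eigenChar_iff]
    intro q
    rw [hb, show ψ i = χ from hi]

/-- **The multiplicity of a system in an eigenbasis**: with `b`, `ψ` as in
`eigenChar_eq_span_image_of_basis`, `dim V_χ = #{i : ψ i = χ}`. [folklore] -/
theorem finrank_eigenChar_eq_card_of_basis (T : ℕ → Module.End ℂ V) (b : Module.Basis ι ℂ V)
    (ψ : ι → PrimesNotDvd N → ℂ) (hb : ∀ (i : ι) (q : PrimesNotDvd N), T q (b i) = ψ i q • b i)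
    (χ : PrimesNotDvd N → ℂ) [Fintype {i // ψ i = χ}] :
    Module.finrank ℂ (eigenChar N T χ) = Fintype.card {i // ψ i = χ} := by
  rw [eigenChar_eq_span_image_of_basis T b ψ hb χ]
  have hrange : b '' {i | ψ i = χ} = Set.range fun i : {i // ψ i = χ} => b i := by
    ext w
    simp only [Set.mem_image, Set.mem_setOf_eq, Set.mem_range, Subtype.exists, exists_prop]
  rw [hrange, finrank_span_eq_card]
  exact b.linearIndependent.comp _ Subtype.val_injective

end LinAlg

/-! ### Multiplicities of eigenvalue systems in `S_k(Γ₀(L))` via the Atkin–Lehner basis -/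

section Modular

variable {N : ℕ} [NeZero N] (L : ℕ) [NeZero L] (k : ℤ)

/-- The Atkin–Lehner index set `{(M, d) : M d ∣ L}` is finite (`M, d` are divisors of `L ≠ 0`).
[folklore] -/
theorem finite_atkinLehnerIndex' : Finite (AtkinLehnerIndex L) := by
  have hL : L ≠ 0 := NeZero.ne L
  have hfin : {x : ℕ × ℕ | x.1 * x.2 ∣ L}.Finite := by
    refine (Finset.finite_toSet (L.divisors ×ˢ L.divisors)).subset ?_
    rintro ⟨a, b⟩ h
    simp only [Set.mem_setOf_eq] at h
    simp only [Finset.coe_product, Set.mem_prod, Finset.mem_coe, Nat.mem_divisors]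
    exact ⟨⟨dvd_of_mul_right_dvd h, hL⟩, ⟨dvd_of_mul_left_dvd h, hL⟩⟩
  exact hfin.to_subtype

/-- The base `{(M, g) : M ∣ L, g ∈ newforms0 M k}` of the Atkin–Lehner family is finite
(`finite_newforms0_holds`). [folklore] -/
theorem finite_sigmaNewform :
    Finite (Σ y : {y : AtkinLehnerIndex L // y.1.2 = 1}, ↥(newforms0 y.1.1.1 k)) := by
  haveI := finite_atkinLehnerIndex' L
  haveI : ∀ y : {y : AtkinLehnerIndex L // y.1.2 = 1}, Finite ↥(newforms0 y.1.1.1 k) :=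
    fun y => (finite_newforms0_holds y.1.1.1 k).to_subtype
  infer_instance

/-- The index set of the Atkin–Lehner family `((M, g), d)`, `M d ∣ L`, is finite. [folklore] -/
theorem finite_alFamilyIndex :
    Finite (Σ j : (Σ y : {y : AtkinLehnerIndex L // y.1.2 = 1}, ↥(newforms0 y.1.1.1 k)),
      {x : AtkinLehnerIndex L // x.1.1 = j.1.1.1.1}) := by
  haveI := finite_atkinLehnerIndex' L
  haveI := finite_sigmaNewform L k
  infer_instance

/-- **Strong multiplicity one off `N`** for the base of the Atkin–Lehner family of a level `L ∣ N`:
two pairs `(M, g)`, `(M', g')` (`g, g'` newforms of levels `M, M' ∣ L`) whose Fourier coefficients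
`a_q` agree at all primes `q ∤ N` coincide — the set of exceptional primes is contained in the
divisors of `N`, hence finite (`IsNewform0.level_eq_of_heckeEigenvalue_eq_holds`,
`IsNewform0.eq_of_heckeEigenvalue_eq_holds`; for a newform `a_q = λ_q`,
`heckeEigenvalue_eq_coeff_of_isNormalized`). [cite: AtkinLehner1970, Thm. 4] -/
theorem sigmaNewform_eq_of_coeff_eq_off
    {j j' : Σ y : {y : AtkinLehnerIndex L // y.1.2 = 1}, ↥(newforms0 y.1.1.1 k)}
    (h : ∀ q : PrimesNotDvd N, (qExpansion 1 ⇑j.2.1).coeff q = (qExpansion 1 ⇑j'.2.1).coeff q) :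
    j = j' := by
  obtain ⟨y, f⟩ := j
  obtain ⟨y', g⟩ := j'
  have hf : IsNewform0 f.1 := f.2
  have hg : IsNewform0 g.1 := g.2
  have hfg : ∀ p : ℕ, p.Prime → ¬ p ∣ N → heckeEigenvalue f.1 p = heckeEigenvalue g.1 p := by
    intro p hp hpN
    rw [heckeEigenvalue_eq_coeff_of_isNormalized hf.2.2 hp (hf.2.1 p hp),
      heckeEigenvalue_eq_coeff_of_isNormalized hg.2.2 hp (hg.2.1 p hp)]
    exact h ⟨p, hp, hpN⟩
  have hfin : {p : ℕ | p.Prime ∧ heckeEigenvalue f.1 p ≠ heckeEigenvalue g.1 p}.Finite := by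
    refine (Finset.finite_toSet N.divisors).subset ?_
    rintro p ⟨hp, hne⟩
    rw [Finset.mem_coe, Nat.mem_divisors]
    exact ⟨by_contra fun hpN => hne (hfg p hp hpN), NeZero.ne N⟩
  have hMM' : y.1.1.1 = y'.1.1.1 := IsNewform0.level_eq_of_heckeEigenvalue_eq_holds hf hg hfin
  have hy : y = y' := Subtype.ext (Subtype.ext (Prod.ext hMM' (y.2.trans y'.2.symm)))
  subst hy
  have hfg' : f.1 = g.1 := IsNewform0.eq_of_heckeEigenvalue_eq_holds hf hg hfin
  have hfg'' : f = g := Subtype.ext hfg'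
  subst hfg''
  rfl

/-- The fibre of the Atkin–Lehner family over a pair `(M, g)` is `{d : M d ∣ L}`, in bijection with
the divisors of `L / M`; so it has `σ₀(L/M)` elements. [folklore] -/
theorem card_atkinLehnerIndex_fst_eq [Fintype (AtkinLehnerIndex L)] {M : ℕ} (hM : M ∣ L) :
    Fintype.card {x : AtkinLehnerIndex L // x.1.1 = M} = (L / M).divisors.card := by
  have hL : L ≠ 0 := NeZero.ne L
  have hLM : L / M ≠ 0 := (Nat.div_pos (Nat.le_of_dvd (Nat.pos_of_ne_zero hL) hM)
    (Nat.pos_of_ne_zero (ne_zero_of_dvd_ne_zero hL hM))).ne'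
  let e : {x : AtkinLehnerIndex L // x.1.1 = M} ≃ ↥(L / M).divisors :=
    { toFun := fun x ↦ ⟨x.1.1.2, Nat.mem_divisors.mpr
        ⟨(Nat.dvd_div_iff_mul_dvd hM).mpr (mul_dvd_of_atkinLehnerIndex_fst_eq x), hLM⟩⟩
      invFun := fun d ↦ ⟨⟨(M, d.1), (Nat.dvd_div_iff_mul_dvd hM).mp (Nat.dvd_of_mem_divisors d.2)⟩, rfl⟩
      left_inv := fun x ↦ by
        rcases x with ⟨⟨⟨M', d⟩, h⟩, hM'⟩
        change M' = M at hM'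
        subst hM'
        rfl
      right_inv := fun d ↦ Subtype.ext rfl }
  rw [Fintype.card_congr e, Fintype.card_coe]

omit [NeZero N] in
/-- **The multiplicity of an eigenvalue system in `S_k(Γ₀(L))`, `L ∣ N`, counted on the
Atkin–Lehner basis**: the dimension of `{f ∈ S_k(Γ₀(L)) : T_q f = χ(q) f ∀ q ∤ N prime}` is the
number of members `[α_d]_k g` of the Atkin–Lehner basis (`g ∈ newforms0 M k`, `M d ∣ L`) with
`a_q(g) = χ(q)` for all primes `q ∤ N`: the basis consists of simultaneous `T_q`-eigenvectors,
`T_q [α_d]_k g = a_q(g) [α_d]_k g` for `q ∤ L` (`heckeT_degeneracyMap0`,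
`IsNewform0.heckeT_eq_coeff_smul`), and `finrank_eigenChar_eq_card_of_basis` applies.
[cite: AtkinLehner1970, Thm. 3 and Thm. 5] -/
theorem finrank_eigenChar_heckeTnGamma0_eq_natCard (hLN : L ∣ N) (χ : PrimesNotDvd N → ℂ) :
    Module.finrank ℂ (eigenChar N (heckeTnGamma0 L k) χ) =
      Nat.card {t : (Σ j : (Σ y : {y : AtkinLehnerIndex L // y.1.2 = 1}, ↥(newforms0 y.1.1.1 k)),
          {x : AtkinLehnerIndex L // x.1.1 = j.1.1.1.1}) //
        ∀ q : PrimesNotDvd N, (qExpansion 1 ⇑t.1.2.1).coeff q = χ q} := by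
  classical
  haveI := finite_alFamilyIndex L k
  letI : Fintype (Σ j : (Σ y : {y : AtkinLehnerIndex L // y.1.2 = 1}, ↥(newforms0 y.1.1.1 k)),
      {x : AtkinLehnerIndex L // x.1.1 = j.1.1.1.1}) := Fintype.ofFinite _
  let b := Module.Basis.mk (linearIndependent_degeneracyMap0_newforms L k)
    (span_range_degeneracyMap0_newforms L k).ge
  let ψ : (Σ j : (Σ y : {y : AtkinLehnerIndex L // y.1.2 = 1}, ↥(newforms0 y.1.1.1 k)),
      {x : AtkinLehnerIndex L // x.1.1 = j.1.1.1.1}) → PrimesNotDvd N → ℂ :=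
    fun t q => (qExpansion 1 ⇑t.1.2.1).coeff q
  have hb : ∀ t (q : PrimesNotDvd N), heckeTnGamma0 L k q (b t) = ψ t q • b t := by
    intro t q
    haveI : NeZero (q : ℕ) := ⟨q.2.1.ne_zero⟩
    have hqL : ¬ (q : ℕ) ∣ L := fun h => q.2.2 (h.trans hLN)
    rw [Module.Basis.mk_apply, heckeTnGamma0_prime L k q q.2.1,
      heckeT_degeneracyMap0 (mul_dvd_of_atkinLehnerIndex_fst_eq t.2) q.2.1 hqL,
      IsNewform0.heckeT_eq_coeff_smul (show IsNewform0 t.1.2.1 from t.1.2.2) q.2.1, map_smul]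
  rw [finrank_eigenChar_eq_card_of_basis (heckeTnGamma0 L k) b ψ hb χ, Nat.card_eq_fintype_card]
  refine Fintype.card_congr (Equiv.subtypeEquivRight fun t => ?_)
  exact funext_iff

variable {L k}

/-- **`m_χ(L) = σ₀(L/M)` when `χ` is the system of a newform `g` of level `M ∣ L`** (off `N`):
by strong multiplicity one the members of the Atkin–Lehner basis with system `χ` are exactly the
`[α_d]_k g`, `d ∣ L/M` (Diamond–Shurman Thm. 5.8.3; Atkin–Lehner 1970, Thm. 5).
[cite: DiamondShurman2005, Thm. 5.8.3] -/
theorem finrank_eigenChar_heckeTnGamma0_eq_card_divisors (hLN : L ∣ N) (χ : PrimesNotDvd N → ℂ)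
    {M : ℕ} [NeZero M] (hML : M ∣ L) {g : CuspForm (Gamma0 M) k} (hg : IsNewform0 g)
    (hχ : ∀ q : PrimesNotDvd N, (qExpansion 1 ⇑g).coeff q = χ q) :
    Module.finrank ℂ (eigenChar N (heckeTnGamma0 L k) χ) = (L / M).divisors.card := by
  classical
  haveI := finite_atkinLehnerIndex' L
  haveI := finite_sigmaNewform L k
  letI : Fintype (AtkinLehnerIndex L) := Fintype.ofFinite _
  letI : Fintype (Σ y : {y : AtkinLehnerIndex L // y.1.2 = 1}, ↥(newforms0 y.1.1.1 k)) :=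
    Fintype.ofFinite _
  rw [finrank_eigenChar_heckeTnGamma0_eq_natCard L k hLN χ]
  -- the distinguished base point `(M, g)`
  let j₀ : Σ y : {y : AtkinLehnerIndex L // y.1.2 = 1}, ↥(newforms0 y.1.1.1 k) :=
    ⟨⟨⟨(M, 1), by rw [mul_one]; exact hML⟩, rfl⟩, ⟨g, hg⟩⟩
  -- every member with system `χ` lies over `j₀`
  have hbase : ∀ t : (Σ j : (Σ y : {y : AtkinLehnerIndex L // y.1.2 = 1}, ↥(newforms0 y.1.1.1 k)),
      {x : AtkinLehnerIndex L // x.1.1 = j.1.1.1.1}),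
      (∀ q : PrimesNotDvd N, (qExpansion 1 ⇑t.1.2.1).coeff q = χ q) ↔ t.1 = j₀ := by
    intro t
    constructor
    · intro ht
      exact sigmaNewform_eq_of_coeff_eq_off L k (j := t.1) (j' := j₀) fun q => by rw [ht q, hχ q]
    · intro ht q
      have : (qExpansion 1 ⇑t.1.2.1).coeff q = (qExpansion 1 ⇑j₀.2.1).coeff q := by rw [ht]
      rw [this]
      exact hχ q
  -- so the subtype is the fibre over `j₀`
  let e : {t : (Σ j : (Σ y : {y : AtkinLehnerIndex L // y.1.2 = 1}, ↥(newforms0 y.1.1.1 k)),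
      {x : AtkinLehnerIndex L // x.1.1 = j.1.1.1.1}) //
        ∀ q : PrimesNotDvd N, (qExpansion 1 ⇑t.1.2.1).coeff q = χ q} ≃
      {x : AtkinLehnerIndex L // x.1.1 = M} :=
    { toFun := fun t => ⟨t.1.2.1, by rw [t.1.2.2, (hbase t.1).mp t.2]⟩
      invFun := fun x => ⟨⟨j₀, x⟩, (hbase ⟨j₀, x⟩).mpr rfl⟩
      left_inv := fun t => by
        rcases t with ⟨⟨j, x⟩, ht⟩
        have hj : j = j₀ := (hbase ⟨j, x⟩).mp ht
        subst hj
        rfl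
      right_inv := fun x => rfl }
  rw [Nat.card_congr e, Nat.card_eq_fintype_card, card_atkinLehnerIndex_fst_eq L hML]

omit [NeZero N] in
/-- **`m_χ(L) = 0` when no newform of level dividing `L` has the system `χ` off `N`.**
[cite: DiamondShurman2005, Thm. 5.8.3] -/
theorem finrank_eigenChar_heckeTnGamma0_eq_zero (hLN : L ∣ N) (χ : PrimesNotDvd N → ℂ)
    (hno : ∀ (M : ℕ) [NeZero M], M ∣ L → ∀ g : CuspForm (Gamma0 M) k, IsNewform0 g →
      ∃ q : PrimesNotDvd N, (qExpansion 1 ⇑g).coeff q ≠ χ q) :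
    Module.finrank ℂ (eigenChar N (heckeTnGamma0 L k) χ) = 0 := by
  rw [finrank_eigenChar_heckeTnGamma0_eq_natCard L k hLN χ, Nat.card_eq_zero]
  left
  refine ⟨fun t => ?_⟩
  obtain ⟨q, hq⟩ := hno t.1.1.1.1.1.1 ((dvd_mul_right _ _).trans t.1.1.1.1.2) t.1.1.2.1 t.1.1.2.2
  exact hq (t.2 q)

/-- Transport of a newform along an equality of levels (the level is a type index). [folklore] -/
theorem exists_isNewform0_of_level_eq {M M' : ℕ} [NeZero M] (h : M = M') {g : CuspForm (Gamma0 M) k}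
    (hg : IsNewform0 g) :
    ∃ (_ : NeZero M') (g' : CuspForm (Gamma0 M') k), IsNewform0 g' ∧
      ∀ n : ℕ, (qExpansion 1 ⇑g').coeff n = (qExpansion 1 ⇑g).coeff n := by
  subst h
  exact ⟨inferInstance, g, hg, fun _ => rfl⟩

end Modular

/-! ### The arithmetic of the `N⁻`-new count -/

section Arithmetic

/-- **`Σ_{e ∣ n} μ(n/e) σ₀(n/e) σ₀(e) = [n = 1]` for squarefree `n`**: the left-hand side is the
Dirichlet convolution `(μ σ₀) * σ₀` of two multiplicative functions, hence multiplicative, and at a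
prime `p` it equals `μ(p) σ₀(p) σ₀(1) + μ(1) σ₀(1) σ₀(p) = -2 + 2 = 0`. [folklore] -/
theorem sum_moebius_mul_card_divisors_mul_card_divisors {n : ℕ} (hn : Squarefree n) :
    ∑ e ∈ n.divisors, (μ (n / e) : ℤ) * ((n / e).divisors.card : ℤ) * (e.divisors.card : ℤ) =
      if n = 1 then 1 else 0 := by
  set G : ArithmeticFunction ℤ :=
    (ArithmeticFunction.moebius.pmul ((σ 0 : ArithmeticFunction ℕ) : ArithmeticFunction ℤ)) *
      ((σ 0 : ArithmeticFunction ℕ) : ArithmeticFunction ℤ) with hG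
  have hGmult : G.IsMultiplicative :=
    (isMultiplicative_moebius.pmul (isMultiplicative_sigma (k := 0)).natCast).mul
      (isMultiplicative_sigma (k := 0)).natCast
  have hGapply : ∀ m : ℕ, G m =
      ∑ e ∈ m.divisors, (μ (m / e) : ℤ) * ((m / e).divisors.card : ℤ) * (e.divisors.card : ℤ) := by
    intro m
    rw [hG, ArithmeticFunction.mul_apply, Nat.sum_divisorsAntidiagonal' (fun a b =>
      (ArithmeticFunction.moebius.pmul ((σ 0 : ArithmeticFunction ℕ) : ArithmeticFunction ℤ)) a *
        ((σ 0 : ArithmeticFunction ℕ) : ArithmeticFunction ℤ) b)]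
    refine Finset.sum_congr rfl fun e _ => ?_
    rw [pmul_apply, natCoe_apply, natCoe_apply, sigma_zero_apply, sigma_zero_apply]
  have hGp : ∀ p : ℕ, p.Prime → G p = 0 := by
    intro p hp
    rw [hGapply, Nat.Prime.divisors hp, Finset.sum_pair hp.one_lt.ne, Nat.div_one,
      Nat.div_self hp.pos, Nat.divisors_one, Nat.Prime.divisors hp,
      Finset.card_pair hp.one_lt.ne, Finset.card_singleton, moebius_apply_prime hp,
      moebius_apply_one]
    norm_num
  rw [← hGapply n]
  split_ifs with h1
  · subst h1
    exact hGmult.map_one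
  · rw [← hGmult.prod_primeFactors hn]
    have hn1 : 1 < n := lt_of_le_of_ne (Nat.one_le_iff_ne_zero.mpr hn.ne_zero) (Ne.symm h1)
    obtain ⟨p, hp⟩ := Nat.nonempty_primeFactors.mpr hn1
    exact Finset.prod_eq_zero hp (hGp p (Nat.prime_of_mem_primeFactors hp))

/-- Reindexing a sum over the divisors `d` of `n` divisible by `a ∣ n` by `d = a e`, `e ∣ n / a`.
[folklore] -/
theorem sum_divisors_ite_dvd_eq {a n : ℕ} (ha : a ∣ n) (hn : n ≠ 0) (F : ℕ → ℤ) :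
    ∑ d ∈ n.divisors, (if a ∣ d then F d else 0) = ∑ e ∈ (n / a).divisors, F (a * e) := by
  classical
  have ha0 : a ≠ 0 := ne_zero_of_dvd_ne_zero hn ha
  have hna : a * (n / a) = n := Nat.mul_div_cancel' ha
  rw [← Finset.sum_filter]
  have hset : n.divisors.filter (fun d => a ∣ d) = (n / a).divisors.image (fun e => a * e) := by
    ext d
    simp only [Finset.mem_filter, Nat.mem_divisors, Finset.mem_image]
    constructor
    · rintro ⟨⟨hd, -⟩, e, rfl⟩
      refine ⟨e, ⟨Nat.dvd_of_mul_dvd_mul_left (Nat.pos_of_ne_zero ha0) (hna.symm ▸ hd), ?_⟩, rfl⟩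
      exact (Nat.div_pos (Nat.le_of_dvd (Nat.pos_of_ne_zero hn) ha) (Nat.pos_of_ne_zero ha0)).ne'
    · rintro ⟨e, ⟨he, -⟩, rfl⟩
      exact ⟨⟨hna ▸ mul_dvd_mul_left a he, hn⟩, dvd_mul_right a e⟩
  rw [hset, Finset.sum_image fun x _ y _ hxy => Nat.eq_of_mul_eq_mul_left (Nat.pos_of_ne_zero ha0) hxy]

end Arithmetic

/-! ### The packaging step: the `N⁻`-new count of an eigenvalue system -/

section Packaging

variable (Nplus Nminus : ℕ) [NeZero Nplus] (k : ℤ)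

/-- **The `N⁻`-new count of an eigenvalue system** (the Atkin–Lehner packaging step of the
trace-formula proof of the Eichler / Jacquet–Langlands correspondence; Eichler 1973, Ch. IV §1;
Pizer 1980, proof of Thm. 2.28). Let `N = N⁺N⁻` with `(N⁺, N⁻) = 1`, `N⁻` squarefree, and for
`L ∣ N` let `m_χ(L)` be the multiplicity of the system `χ = (χ(q))_{q ∤ N}` in `S_k(Γ₀(L))`. Then
either `Σ_{d ∣ N⁻} μ(N⁻/d) σ₀(N⁻/d) m_χ(d N⁺) = 0`, or `χ` is the system of a newform
`g ∈ S_k(Γ₀(N⁻M))` for some `M ∣ N⁺` and the sum equals `σ₀(N⁺/M)`. (By strong multiplicity one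
`χ` belongs to at most one newform `g` of level `M_g = a b ∣ N`, `a ∣ N⁻`, `b ∣ N⁺`; then
`m_χ(d N⁺) = [a ∣ d] σ₀(d/a) σ₀(N⁺/b)` by the Atkin–Lehner basis, and
`Σ_{a ∣ d ∣ N⁻} μ(N⁻/d) σ₀(N⁻/d) σ₀(d/a) = [a = N⁻]`.) [cite: Eichler1973, Ch. IV §1]
[cite: DiamondShurman2005, Thm. 5.8.3] -/
theorem moebius_sum_finrank_eigenChar_eq_zero_or_exists_newform (hsq : Squarefree Nminus)
    (hcop : Nplus.Coprime Nminus) (χ : PrimesNotDvd (Nplus * Nminus) → ℂ) (m : ℕ → ℤ)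
    (hm : ∀ (L : ℕ) [NeZero L], L ∣ Nplus * Nminus →
      m L = Module.finrank ℂ (eigenChar (Nplus * Nminus) (heckeTnGamma0 L k) χ)) :
    (∑ d ∈ Nminus.divisors, (μ (Nminus / d) : ℤ) * ((Nminus / d).divisors.card : ℤ) * m (d * Nplus)
        = 0) ∨
      ∃ (M : ℕ) (_ : NeZero (Nminus * M)) (g : CuspForm (Gamma0 (Nminus * M)) k),
        M ∣ Nplus ∧ IsNewform0 g ∧
        (∀ q : PrimesNotDvd (Nplus * Nminus), (qExpansion 1 ⇑g).coeff q = χ q) ∧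
        ∑ d ∈ Nminus.divisors, (μ (Nminus / d) : ℤ) * ((Nminus / d).divisors.card : ℤ) *
            m (d * Nplus) = ((Nplus / M).divisors.card : ℤ) := by
  classical
  haveI : NeZero Nminus := ⟨hsq.ne_zero⟩
  have hN0 : Nplus * Nminus ≠ 0 := mul_ne_zero (NeZero.ne Nplus) (NeZero.ne Nminus)
  haveI : NeZero (Nplus * Nminus) := ⟨hN0⟩
  -- divisors `d ∣ N⁻` give levels `d N⁺ ∣ N`
  have hlev : ∀ d ∈ Nminus.divisors, d ≠ 0 ∧ d * Nplus ∣ Nplus * Nminus := fun d hd =>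
    ⟨Nat.pos_of_mem_divisors hd |>.ne', by
      rw [mul_comm d]; exact mul_dvd_mul_left Nplus (Nat.dvd_of_mem_divisors hd)⟩
  by_cases hex : ∃ (M : ℕ) (_ : NeZero M), M ∣ Nplus * Nminus ∧ ∃ g : CuspForm (Gamma0 M) k,
      IsNewform0 g ∧ ∀ q : PrimesNotDvd (Nplus * Nminus), (qExpansion 1 ⇑g).coeff q = χ q
  swap
  · -- no newform of level dividing `N` has system `χ`: every multiplicity vanishes
    left
    refine Finset.sum_eq_zero fun d hd => ?_
    obtain ⟨hd0, hdvd⟩ := hlev d hd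
    haveI : NeZero (d * Nplus) := ⟨mul_ne_zero hd0 (NeZero.ne Nplus)⟩
    rw [hm (d * Nplus) hdvd, finrank_eigenChar_heckeTnGamma0_eq_zero hdvd χ fun M _ hM g hg => ?_,
      Nat.cast_zero, mul_zero]
    by_contra hall
    push Not at hall
    exact hex ⟨M, inferInstance, hM.trans hdvd, g, hg, hall⟩
  obtain ⟨M, _, hMN, g, hg, hχ⟩ := hex
  -- `M = b a`, `a = (M, N⁻)`, `b = (M, N⁺)`
  set a := Nat.gcd M Nminus with ha
  set b := Nat.gcd M Nplus with hb
  have hMba : M = b * a := by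
    rw [hb, ha, ← Nat.Coprime.gcd_mul M hcop, Nat.gcd_eq_left hMN]
  have hM0 : M ≠ 0 := NeZero.ne M
  have ha0 : a ≠ 0 := fun h => hM0 (by rw [hMba, h, mul_zero])
  have hb0 : b ≠ 0 := fun h => hM0 (by rw [hMba, h, zero_mul])
  have haN : a ∣ Nminus := Nat.gcd_dvd_right M Nminus
  have hbN : b ∣ Nplus := Nat.gcd_dvd_right M Nplus
  have haM : a ∣ M := Nat.gcd_dvd_left M Nminus
  -- uniqueness of `(M, g)` off `N` (strong multiplicity one)
  have huniq : ∀ (M' : ℕ) [NeZero M'], M' ∣ Nplus * Nminus → ∀ g' : CuspForm (Gamma0 M') k,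
      IsNewform0 g' → (∀ q : PrimesNotDvd (Nplus * Nminus), (qExpansion 1 ⇑g').coeff q = χ q) →
      M' = M := by
    intro M' _ hM'N g' hg' hχ'
    have key := sigmaNewform_eq_of_coeff_eq_off (N := Nplus * Nminus) (Nplus * Nminus) k
      (j := ⟨⟨⟨(M', 1), by rw [mul_one]; exact hM'N⟩, rfl⟩, ⟨g', hg'⟩⟩)
      (j' := ⟨⟨⟨(M, 1), by rw [mul_one]; exact hMN⟩, rfl⟩, ⟨g, hg⟩⟩) fun q => by
        change (qExpansion 1 ⇑g').coeff q = (qExpansion 1 ⇑g).coeff q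
        rw [hχ q, hχ' q]
    exact congrArg (fun j => j.1.1.1.1) key
  -- the multiplicities `m_χ(d N⁺) = [a ∣ d] σ₀(d N⁺ / M)`
  have hmd : ∀ d ∈ Nminus.divisors, m (d * Nplus) =
      if a ∣ d then (((d * Nplus) / M).divisors.card : ℤ) else 0 := by
    intro d hd
    obtain ⟨hd0, hdvd⟩ := hlev d hd
    haveI : NeZero (d * Nplus) := ⟨mul_ne_zero hd0 (NeZero.ne Nplus)⟩
    rw [hm (d * Nplus) hdvd]
    split_ifs with had
    · have hML : M ∣ d * Nplus := by
        rw [hMba, mul_comm b a]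
        exact mul_dvd_mul had hbN
      rw [finrank_eigenChar_heckeTnGamma0_eq_card_divisors hdvd χ hML hg hχ]
    · rw [finrank_eigenChar_heckeTnGamma0_eq_zero hdvd χ fun M' _ hM' g' hg' => ?_, Nat.cast_zero]
      by_contra hall
      push Not at hall
      have hMM' : M' = M := huniq M' (hM'.trans hdvd) g' hg' hall
      apply had
      have haL : a ∣ d * Nplus := haM.trans (hMM' ▸ hM')
      have hacop : a.Coprime Nplus := (Nat.Coprime.coprime_dvd_left haN hcop.symm)
      exact hacop.dvd_of_dvd_mul_right haL
  -- evaluate the alternating sum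
  set n := Nminus / a with hn
  have hna : a * n = Nminus := Nat.mul_div_cancel' haN
  have hnsq : Squarefree n := hsq.squarefree_of_dvd (Nat.div_dvd_of_dvd haN)
  have hsum : ∑ d ∈ Nminus.divisors, (μ (Nminus / d) : ℤ) * ((Nminus / d).divisors.card : ℤ) *
      m (d * Nplus) = ((Nplus / b).divisors.card : ℤ) * (if n = 1 then 1 else 0) := by
    have step1 : ∑ d ∈ Nminus.divisors, (μ (Nminus / d) : ℤ) * ((Nminus / d).divisors.card : ℤ) *
        m (d * Nplus) = ∑ d ∈ Nminus.divisors, (if a ∣ d then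
          (μ (Nminus / d) : ℤ) * ((Nminus / d).divisors.card : ℤ) *
            (((d * Nplus) / M).divisors.card : ℤ) else 0) := by
      refine Finset.sum_congr rfl fun d hd => ?_
      rw [hmd d hd]
      split_ifs <;> simp
    rw [step1, sum_divisors_ite_dvd_eq haN (NeZero.ne Nminus),
      ← sum_moebius_mul_card_divisors_mul_card_divisors hnsq, Finset.mul_sum]
    refine Finset.sum_congr rfl fun e he => ?_
    have he0 : e ≠ 0 := (Nat.pos_of_mem_divisors he).ne'
    have hediv : e ∣ n := Nat.dvd_of_mem_divisors he
    -- `N⁻/(a e) = n/e`, `a e N⁺ / M = e (N⁺/b)`, and `σ₀` is multiplicative on the coprime pair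
    have h1 : Nminus / (a * e) = n / e := by rw [hn, Nat.div_div_eq_div_mul]
    have h2 : a * e * Nplus / M = e * (Nplus / b) := by
      rw [hMba, mul_comm b a, mul_assoc, Nat.mul_div_mul_left _ _ (Nat.pos_of_ne_zero ha0),
        Nat.mul_div_assoc e hbN]
    have hcopr : e.Coprime (Nplus / b) := by
      have he' : e ∣ Nminus := hediv.trans (Nat.div_dvd_of_dvd haN)
      exact Nat.Coprime.coprime_dvd_left he'
        (Nat.Coprime.coprime_dvd_right (Nat.div_dvd_of_dvd hbN) hcop.symm)
    rw [h1, h2, Nat.Coprime.card_divisors_mul hcopr, Nat.cast_mul]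
    ring
  by_cases hn1 : n = 1
  · right
    have haNm : a = Nminus := Nat.eq_of_dvd_of_div_eq_one haN (hn ▸ hn1)
    have hMeq : M = Nminus * b := by rw [hMba, haNm, mul_comm]
    obtain ⟨inst, g', hg', hcoeff⟩ := exists_isNewform0_of_level_eq (k := k) hMeq hg
    refine ⟨b, inst, g', hbN, hg', fun q => by rw [hcoeff, hχ], ?_⟩
    rw [hsum, if_pos hn1, mul_one]
  · left
    rw [hsum, if_neg hn1, mul_zero]

/-- **The packaging step, as used**: if `Σ_{d ∣ N⁻} μ(N⁻/d) σ₀(N⁻/d) m_χ(d N⁺) ≠ 0` then `χ` is the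
eigenvalue system, off `N = N⁺N⁻`, of a newform `g ∈ S_k(Γ₀(N⁻M))` for some `M ∣ N⁺`
(`a_q(g) = χ(q)` for every prime `q ∤ N`). [cite: Eichler1973, Ch. IV §1]
[cite: DiamondShurman2005, Thm. 5.8.3] -/
theorem exists_newform_of_moebius_sum_ne_zero (hsq : Squarefree Nminus)
    (hcop : Nplus.Coprime Nminus) (χ : PrimesNotDvd (Nplus * Nminus) → ℂ) (m : ℕ → ℤ)
    (hm : ∀ (L : ℕ) [NeZero L], L ∣ Nplus * Nminus →
      m L = Module.finrank ℂ (eigenChar (Nplus * Nminus) (heckeTnGamma0 L k) χ))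
    (h : ∑ d ∈ Nminus.divisors, (μ (Nminus / d) : ℤ) * ((Nminus / d).divisors.card : ℤ) *
        m (d * Nplus) ≠ 0) :
    ∃ (M : ℕ) (_ : NeZero (Nminus * M)) (g : CuspForm (Gamma0 (Nminus * M)) k),
      M ∣ Nplus ∧ IsNewform0 g ∧
      ∀ q : ℕ, (hq : q.Prime) → (hqN : ¬ q ∣ Nplus * Nminus) →
        (qExpansion 1 ⇑g).coeff q = χ ⟨q, hq, hqN⟩ := by
  rcases moebius_sum_finrank_eigenChar_eq_zero_or_exists_newform Nplus Nminus k hsq hcop χ m hm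
    with h0 | ⟨M, inst, g, hM, hg, hχ, -⟩
  · exact absurd h0 h
  · exact ⟨M, inst, g, hM, hg, fun q hq hqN => hχ ⟨q, hq, hqN⟩⟩

end Packaging

end BrandtWeightK

end Literature.NumberTheory.Automorphic

end
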